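import Mathlib
import Literature.Computability.AlgebraicComplexity.ArithCircuitWeightedSums
import Literature.Computability.AlgebraicComplexity.IMMInVPProofs
import Summits.ValiantsHypothesis.ValiantsHypothesis.Theorems.FifoMatchingNNDivisionHardShadowCapVertices
import HarnessLib

/-!
# Route FifoMatching — crux `NNDivisionHard` (stmt-ValiantsHypothesis-21181), hyper-degree tier:
# the planar-shadow engine has NO degree-free circuit form (Hrubeš–Yehudayoff 2021, Thm 30, in kernel;
# file 2 of 2: the cost of the witness and the census corollaries)

What is OPEN in `NNDivisionHard` (and in stub B2 `stub_spreadCofactorReduction` of the line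
`division_split` of `NNNotVP`, stmt-11615) is exactly the HYPER-DEGREE tier: certificates
`L₊(NN_n · h) + L₊(h)` with cofactors `h` of total degree `> 2^⌊n^{1/8}⌋`
(`NNDivisionHard.HyperDegree.nnDivisionHard_iff_hyperDegree`, `spreadCofactorReduction_iff_hyperDegree`).
The complementary tier was closed by the SHADOW ENGINE S-exp (`GridCorShadow.expRung_holds`): a located
planar shadow of `NFP_n` has `2^{Ω(√n)}` vertices, a Minkowski summand has at most as many uniquely
supported points as the product, and a monotone FORMULA of size `s` has planar shadows with `≤ 3s+1`
vertices (`DivisionGap.ShadowCofactorSplit.sh_eval_le`, HY21 Lemma 12 / Thm 42); circuits enter only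
through BCS balancing `L ↦ 2^{O(log L · log deg)}` (`formulaComplexity_le_two_pow`) — the degree cap.
Here: that cap cannot be removed from the engine.

* `complexity_of_rec` — the witness `P_n` of `…ShadowCapVertices` (any two-track repeated-squaring
  sequence) has `L₊(P_n) ≤ 6(n+1)(n+2)`: both tracks share ONE circuit by the tree's
  straight-line-program bound `complexity_chain_le_linearOrder`.
* `exists_rec` — the sequences exist (primitive recursion; no definition is introduced).
* ★ `exists_cheap_manyVertices` — **HY21 Thm 30** (explicit constants): complexity `≤ 6(n+1)(n+2)`,
  `≥ 2^n + 1` Newton-polygon vertices.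
* ★ `not_circuit_shadow_bound` — the circuit analogue of the formula engine («`≤ 4(3·size+1)` planar
  shadow vertices», the shape of `GridCorShadow.nn_ncard_extremePoints_le_of_multiple`) is FALSE.
* ★ `not_qp_shadow_bound_of_complexity` — no bound `#vert Newt(f) ≤ 2^((log₂ L₊(f) + a)^a)` holds on
  `ℝ≥0[x, y]`: a degree-free quasi-polynomial S-engine — which, by `nnDivisionHard_iff_hyperDegree`, is
  what the open tier would need from vertex counting — does not exist.  Census reading (informal): the
  hyper-degree tier of 21181 / B2 of 11615 is out of reach of planar-shadow vertex counts; the polytope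
  currency left is virtual extension complexity (line of record `virtual_passenger`, `CorVirtualHard`).

Honest framing: a NEGATIVE calibration (a published theorem, now kernel-checked, read by name against
the tree's engine), not progress on the crux; `NNDivisionHard`, `NNNotVP`, `ZeroOneTransfer` and
`VP ≠ VNP` remain OPEN (NOT proved).  No definitions, no named facts.

References: P. Hrubeš, A. Yehudayoff, *Shadows of Newton polytopes*, CCC 2021 (LIPIcs 200:9), Thm 30,
§5.2, §8 [HrubesYehudayoff2021]; P. Bürgisser, *Completeness and Reduction in Algebraic Complexity
Theory* (2000), Def. 2.1, Rem. 2.7 [Burgisser2000].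
-/

noncomputable section

-- Sub = Summit single-conjunct layout: the duplicated namespace component is mandated by the tree.
set_option linter.dupNamespace false
set_option autoImplicit false

namespace Summit.ValiantsHypothesis.ValiantsHypothesis.Theorems.FifoMatching.NNDivisionHard.ShadowCap

open MvPolynomial Literature.Computability.AlgebraicComplexity
open Finsupp (single)
open scoped NNReal
open Summit.ValiantsHypothesis.ValiantsHypothesis.Theorems.FifoMatching.QueueGridFace (realOf suppPts)

/-! ## The cost: one straight-line program for both tracks -/

/-- repeated squaring: `L(x_i^{2^ℓ}) ≤ ℓ` over `ℝ≥0`. [cite: Burgisser2000, Rem. 2.7] -/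
theorem complexity_X_pow_two_pow_le {τ : Type} (i : τ) (ℓ : ℕ) :
    complexity ((X i : MvPolynomial τ ℝ≥0) ^ 2 ^ ℓ) ≤ ℓ := by
  induction ℓ with
  | zero => rw [pow_zero, pow_one, complexity_X_holds]
  | succ ℓ ih =>
    have h := complexity_aeval_le ((X () : MvPolynomial Unit ℝ≥0) * X ())
      (fun _ => (X i : MvPolynomial τ ℝ≥0) ^ 2 ^ ℓ)
    rw [map_mul, aeval_X, ← pow_add, ← two_mul, ← pow_succ'] at h
    refine h.trans ?_
    have h2 : complexity ((X () : MvPolynomial Unit ℝ≥0) * X ()) ≤ 1 := by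
      have := complexity_mul_le_holds (X () : MvPolynomial Unit ℝ≥0) (X ())
      rw [complexity_X_holds] at this
      omega
    rw [Fintype.sum_unique]
    omega

/-- `L(x_i^{2^ℓ} · x_j^{2^ℓ'}) ≤ ℓ + ℓ' + 1`. [cite: Burgisser2000, Rem. 2.7] -/
theorem complexity_X_pow_mul_X_pow_le {τ : Type} (i j : τ) (ℓ ℓ' : ℕ) :
    complexity ((X i : MvPolynomial τ ℝ≥0) ^ 2 ^ ℓ * X j ^ 2 ^ ℓ') ≤ ℓ + ℓ' + 1 := by
  have := complexity_mul_le_holds ((X i : MvPolynomial τ ℝ≥0) ^ 2 ^ ℓ) (X j ^ 2 ^ ℓ')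
  have h1 := complexity_X_pow_two_pow_le (τ := τ) i ℓ
  have h2 := complexity_X_pow_two_pow_le (τ := τ) j ℓ'
  omega

/-- `1` is free. [cite: Burgisser2000, Def. 2.1] -/
theorem complexity_one_eq {τ : Type} : complexity (1 : MvPolynomial τ ℝ≥0) = 0 := by
  rw [← C_1]
  exact complexity_C_holds 1

/-- `x^a y^b` as a monomial. [folklore] -/
theorem X_pow_mul_X_pow_eq (a b : ℕ) :
    (X 0 : MvPolynomial (Fin 2) ℝ≥0) ^ a * X 1 ^ b = monomial (single 0 a + single 1 b) 1 := by
  rw [X_pow_eq_monomial, X_pow_eq_monomial, monomial_mul, one_mul]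

/-- ★ **`L₊(P_n) ≤ 6 (n+1)(n+2)`** for any two-track repeated-squaring sequence: both tracks in ONE
fan-in-two circuit (the tree's straight-line-program bound `complexity_chain_le_linearOrder` over the
index order `Fin (n+1) ×ₗ Fin 2`; every step costs `≤ 3n + 4`: two repeated-squaring monomials and
`O(1)` gates). [cite: HrubesYehudayoff2021, Thm 30 (§8, last paragraph)] [cite: Burgisser2000, Rem. 2.7] -/
theorem complexity_of_rec (n : ℕ) (P Q : ℕ → MvPolynomial (Fin 2) ℝ≥0)
    (hP0 : P 0 = 1 + monomial (single 0 (2 ^ n) + single 1 (2 ^ (2 * n))) 1) (hQ0 : Q 0 = 1)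
    (hPs : ∀ m, P (m + 1) = P m * P m +
      monomial (single 0 (2 ^ n) + single 1 (2 ^ (2 * n - m - 1))) 1 * (Q m * Q m))
    (hQs : ∀ m, Q (m + 1) = P m * Q m) :
    complexity (P n) ≤ 6 * (n + 1) * (n + 2) := by
  classical
  -- the table, the placeholder variables, the monomials, the steps
  set tab : Fin (n + 1) ×ₗ Fin 2 → MvPolynomial (Fin 2) ℝ≥0 :=
    fun t => if (ofLex t).2 = 0 then P (ofLex t).1 else Q (ofLex t).1 with htab
  set yv : Fin (n + 1) → Fin 2 → MvPolynomial (Fin 2 ⊕ (Fin (n + 1) ×ₗ Fin 2)) ℝ≥0 :=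
    fun m b => X (Sum.inr (toLex (m, b))) with hyv
  set xm : ℕ → MvPolynomial (Fin 2 ⊕ (Fin (n + 1) ×ₗ Fin 2)) ℝ≥0 :=
    fun b => X (Sum.inl 0) ^ 2 ^ n * X (Sum.inl 1) ^ 2 ^ b with hxm
  set prd : Fin (n + 1) → Fin (n + 1) := fun m => ⟨(m : ℕ) - 1, by omega⟩ with hprd
  set step : Fin (n + 1) ×ₗ Fin 2 → MvPolynomial (Fin 2 ⊕ (Fin (n + 1) ×ₗ Fin 2)) ℝ≥0 :=
    fun t => if ((ofLex t).1 : ℕ) = 0 then (if (ofLex t).2 = 0 then 1 + xm (2 * n) else 1)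
      else (if (ofLex t).2 = 0 then
        yv (prd (ofLex t).1) 0 * yv (prd (ofLex t).1) 0 +
          xm (2 * n - (ofLex t).1) * (yv (prd (ofLex t).1) 1 * yv (prd (ofLex t).1) 1)
        else yv (prd (ofLex t).1) 0 * yv (prd (ofLex t).1) 1) with hstep
  -- reading the table
  have htab0 : ∀ m : Fin (n + 1), tab (toLex (m, (0 : Fin 2))) = P m := fun m => by simp [htab]
  have htab1 : ∀ m : Fin (n + 1), tab (toLex (m, (1 : Fin 2))) = Q m := fun m => by simp [htab]
  -- evaluating the building blocks under the substitution of the chain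
  have hxm_eval : ∀ (t : Fin (n + 1) ×ₗ Fin 2) (b : ℕ),
      aeval (Sum.elim X (fun s => if s < t then tab s else 0)) (xm b) =
        monomial (single 0 (2 ^ n) + single 1 (2 ^ b)) 1 := by
    intro t b
    simp only [hxm, map_mul, map_pow, aeval_X, Sum.elim_inl]
    exact X_pow_mul_X_pow_eq _ _
  have hyv_eval : ∀ (m : ℕ) (hm : m + 1 ≤ n) (b b' : Fin 2),
      aeval (Sum.elim X (fun s => if s < toLex ((⟨m + 1, by omega⟩ : Fin (n + 1)), b') then tab s else 0))
        (yv ⟨m, by omega⟩ b) = tab (toLex ((⟨m, by omega⟩ : Fin (n + 1)), b)) := by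
    intro m hm b b'
    simp only [hyv, aeval_X, Sum.elim_inr]
    rw [if_pos]
    simp only [Prod.Lex.toLex_lt_toLex, Fin.lt_def]
    left
    simp
  -- the chain identities
  have hF : ∀ t, tab t = aeval (Sum.elim X (fun s => if s < t then tab s else 0)) (step t) := by
    intro t
    obtain ⟨m, b, rfl⟩ : ∃ m b, t = toLex (m, b) := ⟨(ofLex t).1, (ofLex t).2, by simp⟩
    obtain ⟨m, hm⟩ := m
    obtain hb | hb := (Fin.exists_fin_two (p := fun i => b = i)).1 ⟨b, rfl⟩ <;> subst hb
    · rcases m with _ | m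
      · rw [htab0]
        simp only [hstep, ofLex_toLex, ↓reduceIte, map_add, map_one, hxm_eval]
        exact hP0
      · have hm' : m + 1 ≤ n := by omega
        have hp : prd ⟨m + 1, hm⟩ = ⟨m, by omega⟩ := by simp [hprd]
        rw [htab0]
        simp only [hstep, ofLex_toLex, ↓reduceIte, Nat.add_eq_zero_iff, one_ne_zero, and_false,
          map_add, map_mul, hp, hxm_eval]
        rw [hyv_eval m hm' 0 0, hyv_eval m hm' 1 0, htab0, htab1]
        rw [hPs m]
        rfl
    · rcases m with _ | m
      · rw [htab1]
        simp only [hstep, ofLex_toLex, one_ne_zero, ↓reduceIte, map_one]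
        exact hQ0
      · have hm' : m + 1 ≤ n := by omega
        have hp : prd ⟨m + 1, hm⟩ = ⟨m, by omega⟩ := by simp [hprd]
        rw [htab1]
        simp only [hstep, ofLex_toLex, one_ne_zero, ↓reduceIte, Nat.add_eq_zero_iff, and_false,
          map_mul, hp]
        rw [hyv_eval m hm' 0 1, hyv_eval m hm' 1 1, htab0, htab1]
        exact hQs m
  -- the cost of one step
  have hcost : ∀ t, complexity (step t) ≤ 3 * n + 4 := by
    intro t
    have hy : ∀ m b, complexity (yv m b) = 0 := fun m b => complexity_X_holds _
    have hyy : ∀ m b b', complexity (yv m b * yv m b') ≤ 1 := by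
      intro m b b'
      have := complexity_mul_le_holds (yv m b) (yv m b')
      rw [hy, hy] at this
      omega
    have hx : ∀ b, complexity (xm b) ≤ n + b + 1 := fun b => complexity_X_pow_mul_X_pow_le _ _ n b
    simp only [hstep]
    split_ifs
    · have h1 := complexity_add_le_holds (1 : MvPolynomial (Fin 2 ⊕ (Fin (n + 1) ×ₗ Fin 2)) ℝ≥0)
        (xm (2 * n))
      rw [complexity_one_eq] at h1
      have h2 := hx (2 * n)
      omega
    · rw [complexity_one_eq]; omega
    · have h1 := complexity_add_le_holds (yv (prd (ofLex t).1) 0 * yv (prd (ofLex t).1) 0)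
        (xm (2 * n - (ofLex t).1) * (yv (prd (ofLex t).1) 1 * yv (prd (ofLex t).1) 1))
      have h2 := complexity_mul_le_holds (xm (2 * n - (ofLex t).1))
        (yv (prd (ofLex t).1) 1 * yv (prd (ofLex t).1) 1)
      have h3 := hx (2 * n - (ofLex t).1)
      have h4 := hyy (prd (ofLex t).1) 0 0
      have h5 := hyy (prd (ofLex t).1) 1 1
      omega
    · have := hyy (prd (ofLex t).1) 0 1
      omega
  -- the chain bound
  have hout : P n = tab (toLex (Fin.last n, (0 : Fin 2))) := by rw [htab0]; rfl
  rw [hout]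
  refine (complexity_chain_le_linearOrder tab step hF _).trans ?_
  calc ∑ s : Fin (n + 1) ×ₗ Fin 2, complexity (step s)
      ≤ ∑ _s : Fin (n + 1) ×ₗ Fin 2, (3 * n + 4) := Finset.sum_le_sum fun s _ => hcost s
    _ = (n + 1) * 2 * (3 * n + 4) := by
        rw [Finset.sum_const, Finset.card_univ, smul_eq_mul, Fintype.card_lex, Fintype.card_prod,
          Fintype.card_fin, Fintype.card_fin]
    _ ≤ 6 * (n + 1) * (n + 2) := by nlinarith

/-! ## ★ HY21 Theorem 30 and the census corollaries -/

/-- the two-track sequences exist (primitive recursion). [cite: HrubesYehudayoff2021, §8] -/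
theorem exists_rec (n : ℕ) : ∃ P Q : ℕ → MvPolynomial (Fin 2) ℝ≥0,
    P 0 = 1 + monomial (single 0 (2 ^ n) + single 1 (2 ^ (2 * n))) 1 ∧ Q 0 = 1 ∧
    (∀ m, P (m + 1) = P m * P m +
      monomial (single 0 (2 ^ n) + single 1 (2 ^ (2 * n - m - 1))) 1 * (Q m * Q m)) ∧
    (∀ m, Q (m + 1) = P m * Q m) := by
  let F : ℕ → MvPolynomial (Fin 2) ℝ≥0 × MvPolynomial (Fin 2) ℝ≥0 := fun m =>
    Nat.rec ((1 + monomial (single 0 (2 ^ n) + single 1 (2 ^ (2 * n))) 1, 1))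
      (fun m pq => (pq.1 * pq.1 + monomial (single 0 (2 ^ n) + single 1 (2 ^ (2 * n - m - 1))) 1 *
        (pq.2 * pq.2), pq.1 * pq.2)) m
  exact ⟨fun m => (F m).1, fun m => (F m).2, rfl, rfl, fun m => rfl, fun m => rfl⟩

/-- ★ **Hrubeš–Yehudayoff 2021, Theorem 30 (kernel form, explicit constants):** for every `n` there is
a bivariate polynomial with nonnegative coefficients of monotone circuit complexity `≤ 6(n+1)(n+2)`
whose Newton polygon has at least `2^n + 1` vertices. [cite: HrubesYehudayoff2021, Thm 30] -/
theorem exists_cheap_manyVertices (n : ℕ) :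
    ∃ f : MvPolynomial (Fin 2) ℝ≥0, complexity f ≤ 6 * (n + 1) * (n + 2) ∧
      2 ^ n + 1 ≤ (Set.extremePoints ℝ (convexHull ℝ (suppPts f))).ncard := by
  obtain ⟨P, Q, hP0, hQ0, hPs, hQs⟩ := exists_rec n
  exact ⟨P n, complexity_of_rec n P Q hP0 hQ0 hPs hQs, vertices_of_rec n P Q hP0 hQ0 hPs hQs⟩

/-- ★ **The formula engine has no circuit analogue.**  The planar-shadow bound «a fan-in-two monotone
FORMULA of size `s` computing `f·h'` leaves `Newt(f)` with `≤ 4(3s+1)` shadow vertices»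
(`DivisionGap.ShadowCofactorSplit.sh_eval_le`, `GridCorShadow.nn_ncard_extremePoints_le_of_multiple`,
HY21 Thm 42 / Lemma 12) FAILS for fan-in-two monotone CIRCUITS, already with `h' = 1` and two
variables. [cite: HrubesYehudayoff2021, Thm 30 and §5.2] -/
theorem not_circuit_shadow_bound :
    ¬ ∀ P : ArithCircuit ℝ≥0 (Fin 2), P.IsFanInTwo →
      (Set.extremePoints ℝ (convexHull ℝ (suppPts P.eval))).ncard ≤ 4 * (3 * P.size + 1) := by
  intro H
  obtain ⟨f, hfc, hfv⟩ := exists_cheap_manyVertices 16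
  obtain ⟨P, hP2, hPc, hPs⟩ := ArithCircuit.exists_computes_size_eq_complexity f
  have h1 := H P hP2
  rw [ArithCircuit.Computes] at hPc
  rw [hPc, hPs] at h1
  omega

/-- arithmetic: `2c² + c ≤ 4^c`. [folklore] -/
theorem two_mul_sq_add_le_four_pow (c : ℕ) : 2 * c ^ 2 + c ≤ 4 ^ c := by
  induction c with
  | zero => norm_num
  | succ c ih =>
    rcases Nat.eq_zero_or_pos c with rfl | hc
    · norm_num
    · have h4 : 4 ^ (c + 1) = 4 * 4 ^ c := pow_succ' 4 c
      rw [h4]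
      nlinarith

/-- arithmetic: polylog is eventually below the identity — `(t + c)^c ≤ 2^t` at `t = 4^c - c ≥ 1`.
[folklore] -/
theorem exists_add_pow_le_two_pow (c : ℕ) : ∃ t : ℕ, 1 ≤ t ∧ (t + c) ^ c ≤ 2 ^ t := by
  have h := two_mul_sq_add_le_four_pow c
  refine ⟨4 ^ c - c, ?_, ?_⟩
  · have h1 : 1 ≤ 4 ^ c := Nat.one_le_pow _ _ (by norm_num)
    have h2 : c ≤ 2 * c ^ 2 := by nlinarith
    rcases Nat.eq_zero_or_pos c with rfl | hc
    · norm_num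
    · have : c + 1 ≤ 4 ^ c := by nlinarith
      omega
  · have hc : c ≤ 4 ^ c := le_trans (by nlinarith) h
    rw [Nat.sub_add_cancel hc]
    calc (4 ^ c) ^ c = 2 ^ (2 * c ^ 2) := by
          rw [show (4 : ℕ) = 2 ^ 2 by norm_num, ← pow_mul, ← pow_mul]; ring_nf
      _ ≤ 2 ^ (4 ^ c - c) := Nat.pow_le_pow_right (by norm_num) (by omega)

/-- arithmetic: a quasi-polynomial of a quadratic is eventually below `2^n`. [folklore] -/
theorem qp_of_quadratic_lt (a : ℕ) :
    ∃ n : ℕ, 2 ^ ((Nat.log 2 (6 * (n + 1) * (n + 2)) + a) ^ a) < 2 ^ n + 1 := by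
  -- take `n = 2^t` with `(t + c)^c ≤ 2^t`, `c = 2a + 5`
  obtain ⟨t, ht1, hroot⟩ := exists_add_pow_le_two_pow (2 * a + 5)
  refine ⟨2 ^ t, ?_⟩
  -- `6 (2^t+1)(2^t+2) ≤ 2^(2t+5)`
  have hp1 : 2 ^ (t + 1) = 2 ^ t * 2 := pow_succ 2 t
  have h2t : 2 ≤ 2 ^ t := by
    calc 2 = 2 ^ 1 := by norm_num
      _ ≤ 2 ^ t := Nat.pow_le_pow_right (by norm_num) ht1
  have h1 : 2 ^ t + 1 ≤ 2 ^ (t + 1) := by rw [hp1]; omega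
  have h2 : 2 ^ t + 2 ≤ 2 ^ (t + 1) := by rw [hp1]; omega
  have hsize : 6 * (2 ^ t + 1) * (2 ^ t + 2) ≤ 2 ^ (2 * t + 5) := by
    calc 6 * (2 ^ t + 1) * (2 ^ t + 2) ≤ 8 * 2 ^ (t + 1) * 2 ^ (t + 1) :=
          Nat.mul_le_mul (Nat.mul_le_mul (by norm_num) h1) h2
      _ = 2 ^ (2 * t + 5) := by ring
  have hlog2 : Nat.log 2 (6 * (2 ^ t + 1) * (2 ^ t + 2)) ≤ 2 * t + 5 := by
    calc Nat.log 2 (6 * (2 ^ t + 1) * (2 ^ t + 2)) ≤ Nat.log 2 (2 ^ (2 * t + 5)) := Nat.log_mono_right hsize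
      _ = 2 * t + 5 := Nat.log_pow Nat.one_lt_two _
  -- `(2t + 5 + a)^a ≤ (t + (2a+5))^(2a+5) ≤ 2^t`
  have hbase : 2 * t + 5 + a ≤ (t + (2 * a + 5)) ^ 2 := by nlinarith
  have hexp : (Nat.log 2 (6 * (2 ^ t + 1) * (2 ^ t + 2)) + a) ^ a ≤ (t + (2 * a + 5)) ^ (2 * a + 5) := by
    calc (Nat.log 2 (6 * (2 ^ t + 1) * (2 ^ t + 2)) + a) ^ a ≤ (2 * t + 5 + a) ^ a :=
          Nat.pow_le_pow_left (by omega) a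
      _ ≤ ((t + (2 * a + 5)) ^ 2) ^ a := Nat.pow_le_pow_left hbase a
      _ = (t + (2 * a + 5)) ^ (2 * a) := by rw [← pow_mul]
      _ ≤ (t + (2 * a + 5)) ^ (2 * a + 5) := Nat.pow_le_pow_right (by omega) (by omega)
  have hfin : (Nat.log 2 (6 * (2 ^ t + 1) * (2 ^ t + 2)) + a) ^ a ≤ 2 ^ t := hexp.trans hroot
  calc 2 ^ ((Nat.log 2 (6 * (2 ^ t + 1) * (2 ^ t + 2)) + a) ^ a) ≤ 2 ^ (2 ^ t) :=
        Nat.pow_le_pow_right (by norm_num) hfin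
    _ < 2 ^ (2 ^ t) + 1 := Nat.lt_succ_self _

/-- ★ **No degree-free shadow bound.**  There is no `a` such that the Newton polygon of every bivariate
`f ∈ ℝ≥0[x, y]` has at most `2^((log₂ L₊(f) + a)^a)` vertices — whereas WITH a degree cap such a
bound is exactly what BCS balancing and the formula engine deliver (`formulaComplexity_le_two_pow`,
`sh_eval_le`), and is what closed the tier `deg h ≤ 2^⌊n^{1/8}⌋` of `NNDivisionHard`
(`GridCorShadow.expRung_holds`).  By `NNDivisionHard.HyperDegree.nnDivisionHard_iff_hyperDegree` the
open tier of stmt-21181 (and, via `spreadCofactorReduction_iff_hyperDegree`, stub B2 of stmt-11615)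
is the hyper-degree tier, where only a degree-free engine could act; the vertex count of planar
shadows is therefore NOT such an engine. [cite: HrubesYehudayoff2021, Thm 30 and §5.2] -/
theorem not_qp_shadow_bound_of_complexity :
    ¬ ∃ a : ℕ, ∀ f : MvPolynomial (Fin 2) ℝ≥0,
      (Set.extremePoints ℝ (convexHull ℝ (suppPts f))).ncard ≤ 2 ^ ((Nat.log 2 (complexity f) + a) ^ a) := by
  rintro ⟨a, H⟩
  obtain ⟨n, hn⟩ := qp_of_quadratic_lt a
  obtain ⟨f, hfc, hfv⟩ := exists_cheap_manyVertices n
  have h1 := H f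
  have h3 : 2 ^ ((Nat.log 2 (complexity f) + a) ^ a) ≤
      2 ^ ((Nat.log 2 (6 * (n + 1) * (n + 2)) + a) ^ a) :=
    Nat.pow_le_pow_right (by norm_num)
      (Nat.pow_le_pow_left (Nat.add_le_add_right (Nat.log_mono_right hfc) a) a)
  omega


end Summit.ValiantsHypothesis.ValiantsHypothesis.Theorems.FifoMatching.NNDivisionHard.ShadowCap

end
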